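import Mathlib
import Summits.Schanuel.Statement
import Summits.Schanuel.Schanuel.Theses.RootDecomp1E
import Summits.Schanuel.Schanuel.Theorems.RootDecomp1EAnchorToolkit
import Summits.Schanuel.Schanuel.Theorems.RootDecomp1EEStableRung
import Summits.Schanuel.Schanuel.Theorems.RootDecomp1EEStableStructure
import Summits.Schanuel.Schanuel.Theorems.RootDecomp1EDefectOneSplit
import Summits.Schanuel.Schanuel.Theorems.RootDecomp1EModuleType
import Summits.Schanuel.Schanuel.Theorems.RootDecomp1EMultiplicationTypeLeaves
import Summits.Schanuel.Schanuel.Theorems.RootDecomp1EMultiplicationTypeLeavesEStable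
import Summits.Schanuel.Schanuel.Theorems.RootDecomp1EMultiplicationTypeLeavesGridBlind
import Summits.Schanuel.Schanuel.Theorems.RootDecomp1EOffAxisClosure
import Summits.Schanuel.Schanuel.Theorems.RootDecomp1ELevels
import Summits.Schanuel.Schanuel.Theorems.RootDecomp1ELevelsGrids
import Literature.Barriers.Schanuel.LargeTranscendenceDegree
import Literature.NumberTheory.Transcendental.PeriodsWave0
import Literature.NumberTheory.Transcendental.LindemannWeierstrassProofs

/-!
# RootDecomp1E — lens 2, gen 12 «MULTIPLIER FIELD»: the CM type cut by the degree of its number field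

ROUND 12 of `route-Schanuel-RootDecomp1E` (rev 24, DRAFT, 15/15 CAP FULL), lens 2 = structural dichotomy
(special vs generic).  THEOREM ROUND: one compiling node, `closes` by CALLING the live `RootDecomp1E.closes`.

THE OBJECT.  For a ℚ-free `z : Fin n → ℂ` with span `V`, the MULTIPLIER ALGEBRA `End_alg(V) ∩ ℚ̄ = {β ∈ ℚ̄ : βV ⊆ V}`.
Round 7 cut `S⁻` by «`= ℚ`» (PLAIN, stmt-31410) vs «`≠ ℚ`» (E-STABLE = CM type, stmt-31409).  Round 12 cuts the CM
type by the one remaining invariant of the `ℚ[β]`-module `V`: the DEGREE `d = [ℚ(β):ℚ]` of a multiplier, which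
DIVIDES `n` (tree `degree_dvd`) and determines `V ≅ ℚ(β)^{n/d}` (tree `eStable_structure`):
* **K-LINE** (`IsKLine`, special): some multiplier has full degree `d = n`, i.e. `V = λ·K` for a number field `K`
  with `[K:ℚ] = n` — GEL'FOND's family `(λ, βλ, …, β^{n−1}λ)`;
* **K-MODULE** (`IsKModule`, generic CM): E-stable and every multiplier has degree `< n`, i.e. `V ≅ K^m`, `m ≥ 2`.

KERNEL RESULTS.  Two tree THEOREMS enter as NAMED HYPOTHESES because their proof modules' cones are not built on
the farm at writing time (the 1E precedent of `EStableRung` / `EngineType`): `h29 : smallTrdeg_thm_2_9_pos` (discharged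
by `Literature.Barriers.Schanuel.smallTrdeg_thm_2_9_pos_holds`, module `LargeTranscendenceDegreeThm29Holds`) and
`hN : nesterenko` (discharged by `Literature.NumberTheory.Transcendental.nesterenko_holds`, module
`PeriodsWave0NesterenkoProofs`).  Everything else is hypothesis-free unless a named OPEN statement is displayed.
§1 EXHAUSTIVE and EXCLUSIVE on E-stable spans (`kline_or_kmodule`, `not_kmodule_of_kline`); EXACT:
   `EStableDefectOne ↔ KLineDefectOne ∧ KModuleDefectOne` (`eStableDefectOne_iff_kline_kmodule`); the generic CM type is
   EMPTY AT EVERY PRIME LENGTH and at `n ≤ 3` (`not_kmodule_of_prime`, from the tree's `eStable_prime_isLine`), so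
   `KModuleDefectOne ↔` its restriction to COMPOSITE `n ≥ 4` (`kModuleDefectOne_iff_composite`): the whole CM type of
   `S⁻` at prime lengths is Gel'fond's line family.
§2 K-LINES: coordinate form `V = span(λ, βλ, …, β^{n−1}λ)` (`line_of_kline`); layers `n ≤ 2` (Hermite–Lindemann) and
   `n = 3` (Theorem 2.9, tree-proved) DECIDED; layer `n = 4` DECIDED modulo the registered open statement
   `WaldschmidtConjecture_2_3` (`kline_four_of_conj23`, via the tree's quartic-line theorem), also in the RAW form
   `GelfondLineDefectOne` (no first-failure locality); known floor `trdeg ≥ 2` on every K-line of length `≥ 3`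
   (`two_le_trdeg_of_kline`).  CERTIFIED OPEN MEMBER at `n = 4`: the cyclotomic line
   `cycLine = log 2·(1, ζ₅, ζ₅², ζ₅³)` — ℚ-free, K-line with `K = ℚ(ζ₅)` (`[K:ℚ] = 4` by `cyclotomic_eq_minpoly_rat`),
   floor `2` PROVED, conclusion `⟺ 3 ≤ trdeg ℚ(ζ₅^k log 2, 2^{ζ₅^k})` = the `t₂`-clause of Conjecture 2.3 on the
   `(4,4)` Gel'fond–Schneider grid of `(log 2, ζ₅)`, implied by the Gel'fond–Schneider conjecture for quartic `β`
   (printed reach `[(d+1)/2] = 2`: barrier B3 `LargeTranscendenceDegree`, Corollary 2.8) — OPEN.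
§3 K-MODULES at the first composite length: `BiplaneDefectOneFour` (= `KModuleDefectOne` at `n = 4`; every multiplier
   field is QUADRATIC, `quadratic_of_kmodule_four`) and its member-certifiable form `BiplaneDefectOneFour'`
   (`trdeg F_z ≥ 2` in place of sub-minimality; `S⁻ ⟹ it ⟹ BiplaneDefectOneFour`).  CERTIFIED OPEN MEMBER: the
   Gaussian biplane `G = (1, i, π, πi)` — ℚ-free, `ℚ(i)`-module of rank 2 with multiplier algebra EXACTLY quadratic
   (π transcendental), floor `trdeg F_G ≥ 2` PROVED (Lindemann–Weierstrass on `(e, eⁱ)`), conclusion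
   `⟺ 3 ≤ trdeg ℚ(π, e^π, e, eⁱ)` (`G_conclusion_iff`): «`e` and `eⁱ` are not both algebraic over `ℚ(π, e^π)`» — one
   number beyond Nesterenko, OPEN; `G` admits no full `(4,4)` span grid, so even Conjecture 2.3 outputs `≤ 2` there.
§3c THE DICTIONARY with round 11's grid cell (kernel, hypothesis-free): on ℚ-free quadruples
   `FullGridFour z ↔ IsKLine z` (`fullGridFour_iff_kline`; `⟸` by `x = (β^i)`, `y = (β^jλ)`; `⟹` via the MULTIPLIER
   ALGEBRA `multiplierSubalgebra V` and a primitive element of the number field generated by the normalised grid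
   column ratios).  So Waldschmidt's Conjecture 2.3 — whose `t₂`-output reaches `n − 1 = 3` only on full grids — bites
   EXACTLY the K-line half of the CM type, and is INERT ON THE WHOLE K-MODULE CELL (`conj23_inert_on_kmodule_four`:
   every span-grid of a K-module quadruple has conjectural output `≤ 2`); `G_not_fullGridFour`, `cycLine_fullGridFour`.
§4 (critic E-R12 (c′)) THE OUTPUT-3 ENGINE: `GammaRich z` (`π, e^π, Γ(1/4)` algebraic over `F_z`) ⟹ `trdeg F_z ≥ 3`
   HYPOTHESIS-FREE (tree theorem `nesterenko_holds` transported to ℂ) — decides `S⁻` on Γ-rich quadruples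
   (`defectOne_four_of_gammaRich`; padded for `S⁻`, declared) and FULL `S` on Γ-rich triples
   (`schanuel_three_of_gammaRich`); INERT from `n = 5` on (`three_le_trdeg_of_subMinimal_five`: sub-minimality alone
   gives `3`).  The E-stable Γ-quadruple `(π, πi, log Γ(1/4), i log Γ(1/4))` is decided with UNKNOWN K-type (line iff
   `log Γ(1/4)/π` is quadratic over `ℚ(i)`).
§5 `closes`: `KLineDefectOne → KModuleDefectOne → PlainDefectOne → (dark chain of rev 24) → Schanuel`, by calling
   `RootDecomp1E.closes` through the CLOSED glue `defectOneSchanuelGlue_holds` and `offAxisClosure_holds`.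
-/


/-!
# RootDecomp1EMultiplierField — part 1/4 of the port of lens-2 gen 12 «MULTIPLIER FIELD» (ROUND 12 of route-Schanuel-RootDecomp1E, THEOREM ROUND)

§1–§2: the multiplier degree (K-lines vs K-modules: exhaustive / exclusive / exact; empty at primes) and K-lines (coordinates, decided layers n ≤ 3, layer 4 mod Conjecture 2.3).

Port (census-1 gen 8) of HOME/decomp-schanuel-lens-2/g12/MultiplierField.lean (sha256 5884507d…, 910 l; critic VERDICT 2026-08-30T15:36:56Z
ACCEPTED — PATH T, port CLEARED with hygiene h1–h4: the two unused simp arguments dropped; cell predicates are DEFINITIONS of this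
decomposition (not cited facts); the tree theorems `smallTrdeg_thm_2_9_pos` / `nesterenko` stay explicit binders h29 / hN as in
RootDecomp1EEStableRung; `closes` kept, informational). Namespace `Summit.Schanuel.Schanuel.Theorems.RootDecomp1EMultiplierField` (node: …Theses.MultiplierField);
statements and proofs verbatim. `--supports stmt-Schanuel-31409` (EStableDefectOne, the CM type). Sorry-free; standard axioms.
Nothing here proves Schanuel; rung 0.
-/

set_option linter.dupNamespace false

namespace Summit.Schanuel.Schanuel.Theorems.RootDecomp1EMultiplierField


open Complex IntermediateField Module Polynomial
open Summit.Schanuel.Schanuel.Theses.RootDecomp1E (DefectOneSchanuel EStableDefectOne PlainDefectOne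
  ClosedFormAtomSchanuel AlgAnchoredDarkAtomSchanuel LineLogDarkAtomSchanuel DeepLogDarkAtomSchanuel
  OffAxisClosure FreeDarkAtomSchanuel)
open Summit.Schanuel.Schanuel.Theorems.RootDecomp1EAnchor (isAlgebraic_of_mem_adjoin trdeg_adjoin_le_of_isAlgebraic
  mem_adjoin_of_mem_span exp_isAlgebraic_of_mem_span trdeg_le_of_mem_span trdeg_eq_of_span_eq offAxisClosure_holds)
open Summit.Schanuel.Schanuel.Theorems.RootDecomp1EEStableStructure (degree_dvd eStable_structure eStable_prime_isLine)
open Summit.Schanuel.Schanuel.Theorems.RootDecomp1EEStableRung (defectOne_of_le_two mul_mem_span_of_gens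
  one_beta_linearIndependent two_le_trdeg_of_eStable_three)
open Summit.Schanuel.Schanuel.Theorems.RootDecomp1EDefectOneSplit (defectOneSchanuelGlue_holds)
open Summit.Schanuel.Schanuel.Theorems.RootDecomp1EModuleType (SubMinimalDefect)
open Summit.Schanuel.Schanuel.Theorems.RootDecomp1EModuleGrids (rat_mul_pi_eq_rat)
open Summit.Schanuel.Schanuel.Theorems.RootDecomp1EMultiplicationTypeLeaves (defectOne_quarticLine_of_conj23
  two_le_trdeg_of_eStable sub_two_le_trdeg_of_subMinimal)
open Summit.Schanuel.Schanuel.Theorems.RootDecomp1ELevels (LWLevel le_trdeg_of_algebraicIndependent le_trdeg_of_lwLevel)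
open Literature.Barriers.Schanuel (smallTrdeg_thm_2_9_pos WaldschmidtConjecture_2_3 isAlgebraic_I)
open Literature.NumberTheory.Transcendental (nesterenko transcendental_pi_holds algebraicIndependent_exp_holds)

noncomputable section

/-! ## §1 The multiplier degree: K-LINES vs K-MODULES, exhaustive / exclusive / exact; empty at primes -/

/-- `span_ℚ z` is E-STABLE (stmt-31409's hypothesis, verbatim): an irrational algebraic multiplier exists. -/
def EStable {n : ℕ} (z : Fin n → ℂ) : Prop :=
  ∃ β : ℂ, IsAlgebraic ℚ β ∧ β ∉ Set.range (algebraMap ℚ ℂ) ∧ ∀ i, β * z i ∈ Submodule.span ℚ (Set.range z)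

/-- **K-LINE** (special CM type): some algebraic multiplier has FULL degree `n`; then `span_ℚ z = λ·ℚ(β)`. -/
def IsKLine {n : ℕ} (z : Fin n → ℂ) : Prop :=
  ∃ β : ℂ, IsAlgebraic ℚ β ∧ (minpoly ℚ β).natDegree = n ∧ ∀ i, β * z i ∈ Submodule.span ℚ (Set.range z)

/-- **K-MODULE** (generic CM type): E-stable, and EVERY algebraic multiplier has degree `< n` (so `span ≅ K^m`, `m ≥ 2`). -/
def IsKModule {n : ℕ} (z : Fin n → ℂ) : Prop :=
  EStable z ∧ ∀ β : ℂ, IsAlgebraic ℚ β → (∀ i, β * z i ∈ Submodule.span ℚ (Set.range z)) →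
    (minpoly ℚ β).natDegree < n

/-- `S⁻` at the first failure on K-LINES (child of stmt-31409). -/
def KLineDefectOne : Prop :=
  ∀ (n : ℕ) (z : Fin n → ℂ), LinearIndependent ℚ z → IsKLine z → SubMinimalDefect n z →
    (n : Cardinal) ≤ Algebra.trdeg ℚ ↥(adjoin ℚ (Set.range z ∪ Set.range (cexp ∘ z))) + 1

/-- `S⁻` at the first failure on K-MODULES (child of stmt-31409; the generic CM residual). -/
def KModuleDefectOne : Prop :=
  ∀ (n : ℕ) (z : Fin n → ℂ), LinearIndependent ℚ z → IsKModule z → SubMinimalDefect n z →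
    (n : Cardinal) ≤ Algebra.trdeg ℚ ↥(adjoin ℚ (Set.range z ∪ Set.range (cexp ∘ z))) + 1

/-- **GEL'FOND LINES**, raw form (no first-failure locality): `S⁻` on EVERY number-field line `λ·K`, `[K:ℚ] = n`:
«for a number field `K` of degree `n` and `λ ≠ 0`, `trdeg ℚ(λK, e^{λK}) ≥ n − 1`». -/
def GelfondLineDefectOne : Prop :=
  ∀ (n : ℕ) (z : Fin n → ℂ), LinearIndependent ℚ z → IsKLine z →
    (n : Cardinal) ≤ Algebra.trdeg ℚ ↥(adjoin ℚ (Set.range z ∪ Set.range (cexp ∘ z))) + 1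

/-- An algebraic number of degree `≥ 2` is irrational. -/
theorem not_mem_range_of_two_le {β : ℂ} (hβ : IsAlgebraic ℚ β) (h2 : 2 ≤ (minpoly ℚ β).natDegree) :
    β ∉ Set.range (algebraMap ℚ ℂ) := by
  have h := (minpoly.two_le_natDegree_iff hβ.isIntegral).mp h2
  rintro ⟨q, hq⟩
  exact h ⟨q, hq⟩

/-- An irrational algebraic number has degree `≥ 2`. -/
theorem two_le_of_not_mem_range {β : ℂ} (hβ : IsAlgebraic ℚ β) (hβq : β ∉ Set.range (algebraMap ℚ ℂ)) :
    2 ≤ (minpoly ℚ β).natDegree := by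
  rw [minpoly.two_le_natDegree_iff hβ.isIntegral]
  rintro ⟨q, hq⟩
  exact hβq ⟨q, hq⟩

/-- A K-line of length `n ≥ 2` is E-stable. -/
theorem eStable_of_kline {n : ℕ} (hn : 2 ≤ n) {z : Fin n → ℂ} (hK : IsKLine z) : EStable z := by
  obtain ⟨β, hβ, hd, hβV⟩ := hK
  exact ⟨β, hβ, not_mem_range_of_two_le hβ (hd ▸ hn), hβV⟩

/-- **EXHAUSTIVE.** An E-stable ℚ-free tuple of length `n ≥ 1` is a K-line or a K-module (the degree of any
multiplier divides `n`: tree `degree_dvd`). -/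
theorem kline_or_kmodule {n : ℕ} (hn : 1 ≤ n) {z : Fin n → ℂ} (hz : LinearIndependent ℚ z) (hE : EStable z) :
    IsKLine z ∨ IsKModule z := by
  by_cases h : ∃ β : ℂ, IsAlgebraic ℚ β ∧ (minpoly ℚ β).natDegree = n ∧
      ∀ i, β * z i ∈ Submodule.span ℚ (Set.range z)
  · exact Or.inl h
  · refine Or.inr ⟨hE, fun β hβ hβV => ?_⟩
    have hle : (minpoly ℚ β).natDegree ≤ n := Nat.le_of_dvd hn (degree_dvd z hz hβ hβV)
    exact lt_of_le_of_ne hle fun heq => h ⟨β, hβ, heq, hβV⟩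

/-- **EXCLUSIVE.** -/
theorem not_kmodule_of_kline {n : ℕ} {z : Fin n → ℂ} (hK : IsKLine z) : ¬ IsKModule z := by
  rintro ⟨-, hM⟩
  obtain ⟨β, hβ, hd, hβV⟩ := hK
  have := hM β hβ hβV
  omega

/-- `S⁻ ⟹` each piece (weakenings). -/
theorem kline_of_defectOne (hD : DefectOneSchanuel) : KLineDefectOne := fun n z hz _ _ => hD n z hz

/-- `KModuleDefectOne`. -/
theorem kmodule_of_defectOne (hD : DefectOneSchanuel) : KModuleDefectOne := fun n z hz _ _ => hD n z hz

/-- `GelfondLineDefectOne`. -/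
theorem gelfondLine_of_defectOne (hD : DefectOneSchanuel) : GelfondLineDefectOne := fun n z hz _ => hD n z hz

/-- `KLineDefectOne`. -/
theorem kLineDefectOne_of_gelfondLine (h : GelfondLineDefectOne) : KLineDefectOne := fun n z hz hK _ => h n z hz hK

/-- **EXACTNESS of the cut of stmt-31409.** -/
theorem eStableDefectOne_iff_kline_kmodule : EStableDefectOne ↔ KLineDefectOne ∧ KModuleDefectOne := by
  constructor
  · intro hE
    refine ⟨fun n z hz hK hsub => ?_, fun n z hz hK hsub => hE n z hz hK.1 hsub⟩
    by_cases h2 : n ≤ 2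
    · exact defectOne_of_le_two n h2 z hz
    · exact hE n z hz (eStable_of_kline (by omega) hK) hsub
  · rintro ⟨hL, hM⟩ n z hz hEz hsub
    rcases Nat.eq_zero_or_pos n with rfl | hn
    · simp
    · rcases kline_or_kmodule hn hz hEz with h | h
      · exact hL n z hz h hsub
      · exact hM n z hz h hsub

/-- `EStableDefectOne`. -/
theorem eStableDefectOne_of_kline_kmodule (hL : KLineDefectOne) (hM : KModuleDefectOne) : EStableDefectOne :=
  eStableDefectOne_iff_kline_kmodule.mpr ⟨hL, hM⟩

/-- `S⁻ ⟺ GEL'FOND-LINES-at-first-failure ∧ K-MODULES ∧ PLAIN` (with round 7's exact split). -/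
theorem defectOne_iff_kline_kmodule_plain :
    DefectOneSchanuel ↔ KLineDefectOne ∧ KModuleDefectOne ∧ PlainDefectOne :=
  ⟨fun hD => ⟨kline_of_defectOne hD, kmodule_of_defectOne hD,
      fun n z hz _ _ => hD n z hz⟩,
    fun ⟨hL, hM, hP⟩ => defectOneSchanuelGlue_holds (eStableDefectOne_of_kline_kmodule hL hM) hP⟩

/-! ### §1b The generic CM type is empty at prime lengths (and at `n ≤ 3`) -/

/-- At a PRIME length every E-stable free span is a K-line (tree `eStable_prime_isLine`). -/
theorem kline_of_prime {n : ℕ} (hp : n.Prime) {z : Fin n → ℂ} (hz : LinearIndependent ℚ z) (hE : EStable z) :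
    IsKLine z := by
  obtain ⟨β, hβ, hβq, hβV⟩ := hE
  exact ⟨β, hβ, (eStable_prime_isLine hp z hz hβ hβq hβV).1, hβV⟩

/-- Hence NO K-module has prime length. -/
theorem not_kmodule_of_prime {n : ℕ} (hp : n.Prime) {z : Fin n → ℂ} (hz : LinearIndependent ℚ z) :
    ¬ IsKModule z := fun h => not_kmodule_of_kline (kline_of_prime hp hz h.1) h

/-- No free singleton is E-stable. -/
theorem not_eStable_one (z : Fin 1 → ℂ) (hz : LinearIndependent ℚ z) : ¬ EStable z := by
  rintro ⟨β, hβ, hβq, hβV⟩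
  have h1 : (minpoly ℚ β).natDegree = 1 := Nat.dvd_one.mp (degree_dvd z hz hβ hβV)
  have h2 := two_le_of_not_mem_range hβ hβq
  omega

/-- The K-module layers at lengths `0, 1, 2, 3, 5, 7, 11, …` are VACUOUS: `KModuleDefectOne` is its restriction to
COMPOSITE lengths `n ≥ 4` — the biplanes over quadratic fields at `n = 4` are the FIRST generic-CM cell. -/
theorem kModuleDefectOne_iff_composite :
    KModuleDefectOne ↔ ∀ n : ℕ, 4 ≤ n → ¬ n.Prime → ∀ z : Fin n → ℂ, LinearIndependent ℚ z → IsKModule z →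
      SubMinimalDefect n z →
      (n : Cardinal) ≤ Algebra.trdeg ℚ ↥(adjoin ℚ (Set.range z ∪ Set.range (cexp ∘ z))) + 1 := by
  constructor
  · exact fun h n _ _ z hz hK hsub => h n z hz hK hsub
  · intro h n z hz hK hsub
    by_cases hp : n.Prime
    · exact absurd hK (not_kmodule_of_prime hp hz)
    obtain h0 | h1 | h4 : n = 0 ∨ n = 1 ∨ 4 ≤ n := by
      rcases Nat.lt_or_ge n 4 with hlt | hge
      · interval_cases n <;> simp_all [Nat.prime_two, Nat.prime_three]
      · exact Or.inr (Or.inr hge)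
    · subst h0; simp
    · subst h1; exact absurd hK.1 (not_eStable_one z hz)
    · exact h n h4 hp z hz hK hsub

/-! ## §2 K-LINES: coordinates, decided layers `n ≤ 3`, layer `4` modulo Conjecture 2.3, the cyclotomic member -/

/-- **COORDINATES OF A K-LINE**: `span_ℚ z = span(λ, βλ, …, β^{n−1}λ)` with `[ℚ(β):ℚ] = n` (tree `eStable_structure`
with `m = n/d = 1`). -/
theorem line_of_kline {n : ℕ} (hn : 1 ≤ n) {z : Fin n → ℂ} (hz : LinearIndependent ℚ z) (hK : IsKLine z) :
    ∃ β lam : ℂ, IsAlgebraic ℚ β ∧ (minpoly ℚ β).natDegree = n ∧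
      lam ∈ Submodule.span ℚ (Set.range z) ∧ (∀ i, β * z i ∈ Submodule.span ℚ (Set.range z)) ∧
      LinearIndependent ℚ (fun k : Fin n => β ^ (k : ℕ) * lam) ∧
      Submodule.span ℚ (Set.range fun k : Fin n => β ^ (k : ℕ) * lam) = Submodule.span ℚ (Set.range z) := by
  obtain ⟨β, hβ, hdn, hβV⟩ := hK
  obtain ⟨m, u, hmn, hu, hli, hspan⟩ := eStable_structure z hz hβ hβV
  rw [hdn] at hmn
  have hm : m = 1 := Nat.eq_of_mul_eq_mul_left hn (hmn.trans (Nat.mul_one n).symm)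
  subst hm
  let e : Fin n ≃ Fin (minpoly ℚ β).natDegree × Fin 1 :=
    (finCongr hdn.symm).trans (Equiv.prodUnique (Fin (minpoly ℚ β).natDegree) (Fin 1)).symm
  have hcomp : (fun p : Fin (minpoly ℚ β).natDegree × Fin 1 => β ^ (p.1 : ℕ) * u p.2) ∘ e =
      fun k : Fin n => β ^ (k : ℕ) * u 0 := by
    funext k; simp [e, Fin.default_eq_zero]
  refine ⟨β, u 0, hβ, hdn, hu 0, hβV, ?_, ?_⟩
  · rw [← hcomp]; exact hli.comp e e.injective
  · rw [← hspan, ← hcomp, e.surjective.range_comp]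

/-- **K-LINE LAYERS `n ≤ 2` DECIDED** (Hermite–Lindemann; in fact every free span). -/
private theorem kline_le_two (n : ℕ) (hn : n ≤ 2) (z : Fin n → ℂ) (hz : LinearIndependent ℚ z) :
    (n : Cardinal) ≤ Algebra.trdeg ℚ ↥(adjoin ℚ (Set.range z ∪ Set.range (cexp ∘ z))) + 1 :=
  defectOne_of_le_two n hn z hz

/-- **KNOWN FLOOR on K-lines of length `≥ 3`: `trdeg F_z ≥ 2`** (Theorem 2.9 `t₂`, PROVED in tree, hypothesis-free). -/
theorem two_le_trdeg_of_kline (h29 : smallTrdeg_thm_2_9_pos) {n : ℕ} (hn : 3 ≤ n) {z : Fin n → ℂ}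
    (hz : LinearIndependent ℚ z) (hK : IsKLine z) :
    (2 : Cardinal) ≤ Algebra.trdeg ℚ ↥(adjoin ℚ (Set.range z ∪ Set.range (cexp ∘ z))) := by
  obtain ⟨β, hβ, hβq, hβV⟩ := eStable_of_kline (by omega) hK
  exact two_le_trdeg_of_eStable h29 hn z hz β hβ hβq hβV

/-- **K-LINE LAYER `n = 3` DECIDED** (cubic lines; round 7's decided layer, here hypothesis-free). -/
theorem kline_three (h29 : smallTrdeg_thm_2_9_pos) (z : Fin 3 → ℂ) (hz : LinearIndependent ℚ z) (hK : IsKLine z) :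
    ((3 : ℕ) : Cardinal) ≤ Algebra.trdeg ℚ ↥(adjoin ℚ (Set.range z ∪ Set.range (cexp ∘ z))) + 1 := by
  have h := add_le_add (two_le_trdeg_of_kline h29 le_rfl hz hK) (le_refl (1 : Cardinal))
  have e : (2 : Cardinal) + 1 = ((3 : ℕ) : Cardinal) := by norm_num
  rwa [e] at h

/-- **K-LINE LAYER `n = 4` DECIDED modulo Waldschmidt's Conjecture 2.3** (registered OPEN statement; tree theorem
`defectOne_quarticLine_of_conj23` on the coordinates of `line_of_kline`, transported by span-invariance of `trdeg`). -/
theorem kline_four_of_conj23 (h23 : WaldschmidtConjecture_2_3) (z : Fin 4 → ℂ) (hz : LinearIndependent ℚ z)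
    (hK : IsKLine z) :
    ((4 : ℕ) : Cardinal) ≤ Algebra.trdeg ℚ ↥(adjoin ℚ (Set.range z ∪ Set.range (cexp ∘ z))) + 1 := by
  obtain ⟨β, lam, hβ, -, -, hβV, hli, hspan⟩ := line_of_kline (by norm_num) hz hK
  set w : Fin 4 → ℂ := ![lam, β * lam, β ^ 2 * lam, β ^ 3 * lam] with hw_def
  have hw : (fun k : Fin 4 => β ^ (k : ℕ) * lam) = w := by
    funext k; fin_cases k <;> simp [w]
  rw [hw] at hli hspan
  have hwz : ∀ j, w j ∈ Submodule.span ℚ (Set.range z) := fun j =>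
    hspan ▸ Submodule.subset_span ⟨j, rfl⟩
  have hzw : ∀ i, z i ∈ Submodule.span ℚ (Set.range w) := fun i =>
    hspan.symm ▸ Submodule.subset_span ⟨i, rfl⟩
  have h4 : β ^ 4 * lam ∈ Submodule.span ℚ (Set.range w) := by
    have h3 : β ^ 3 * lam ∈ Submodule.span ℚ (Set.range z) := by simpa [w] using hwz 3
    have := mul_mem_span_of_gens hβV h3
    rw [hspan]
    convert this using 1
    ring
  have h := defectOne_quarticLine_of_conj23 h23 lam β hβ hli h4
  rwa [trdeg_eq_of_span_eq hwz hzw] at h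

/-- Layers `n ≤ 4` of the raw Gel'fond family, modulo Conjecture 2.3. -/
theorem gelfondLine_le_four_of_conj23 (h29 : smallTrdeg_thm_2_9_pos) (h23 : WaldschmidtConjecture_2_3) (n : ℕ)
    (hn : n ≤ 4) (z : Fin n → ℂ) (hz : LinearIndependent ℚ z) (hK : IsKLine z) :
    (n : Cardinal) ≤ Algebra.trdeg ℚ ↥(adjoin ℚ (Set.range z ∪ Set.range (cexp ∘ z))) + 1 := by
  rcases Nat.lt_or_ge n 3 with h | h
  · exact kline_le_two n (by omega) z hz
  · interval_cases n
    · exact kline_three h29 z hz hK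
    · exact kline_four_of_conj23 h23 z hz hK

/-- `4 ≤ t + 1 ⟺ 3 ≤ t` in `Cardinal` (reading the conclusion of a length-4 layer). -/
theorem four_le_add_one_iff (t : Cardinal) : ((4 : ℕ) : Cardinal) ≤ t + 1 ↔ (3 : Cardinal) ≤ t := by
  rw [show ((4 : ℕ) : Cardinal) = 3 + 1 by norm_num]
  exact Cardinal.add_one_le_add_one_iff

/-- Multiplying a ℚ-free family by a non-zero number keeps it ℚ-free. -/
theorem linearIndependent_mul_const {m : ℕ} {x : Fin m → ℂ} (hx : LinearIndependent ℚ x) {c : ℂ} (hc : c ≠ 0) :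
    LinearIndependent ℚ (fun k => x k * c) :=
  hx.map' (LinearMap.mulRight ℚ c)
    (LinearMap.ker_eq_bot.mpr fun a b hab => mul_left_injective₀ hc (by simpa using hab))

/-- `i ∉ ℚ`. -/
theorem I_not_mem_range : I ∉ Set.range (algebraMap ℚ ℂ) := by
  rintro ⟨q, hq⟩
  rw [eq_ratCast] at hq
  have h := congrArg Complex.im hq
  simp at h


end

end Summit.Schanuel.Schanuel.Theorems.RootDecomp1EMultiplierField
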